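import Summits.CriticalPhenomena.PercolationContinuityZ3.Theorems.PercNearOneGluingNoHeavyLowerTailSahiCTCLadderThreeRowThreeBounds
import HarnessLib

/-!
# `NoHeavyLowerTail` (crux stmt-CriticalPhenomena-4575), P3 lane: summed cube bounds for the row `#dbl = 3` of `(L_3)`

Support file (seat `prim-l12-p3`, gen 26; `--supports stmt-CriticalPhenomena-4575`).  Paper proof `prim-l12-p3/ROW3-PROOF-g26.md` §4–5.
With `D = dbl m` (`#D = 3`), `T = lev m 1` (`τ = #T`) and, for `d ∈ D` and `x ∈ D∖d`, the C-set `csetL2 m d x = {y ∈ T : d+x+y ∈ 𝒳 ∩ 𝒵}`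
(the common neighbours of `x` among `T` in the link at `d`), this file sums the per-cube bounds of `…LadderThreeRowThreeBounds` over the cubes of
one family: the DEGREE sums `Σ_{y₀} κ₂(d,y₀) ≥ 2τ + (τ−1)·#C` (with the α-edge, `sum_kapL2_ge_deg_alpha`) and `≥ τ + (τ−1)·#C` (`#C ≥ 2`,
`sum_kapL2_ge_deg`), the TRIANGLE sum `Σ_{y₀} κ₂(d,y₀) ≥ τ(τ+2)` when `D` is common and two C-sets at `d` meet in ≥ 2 points
(`sum_kapL2_ge_tri`), the LOOP sums for the 1-live cubes (`sum_kapL1_ge_alpha`, `sum_kapL1_ge_of_three_le`) and the count of the C₁-type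
charged sets (`card_WC1_le`).  Nothing is asserted about the crux.
-/

namespace Summit.CriticalPhenomena.PercolationContinuityZ3.Theorems.SahiCTCForms

open Finset MvPolynomial SahiCTCGenFun SahiCTCWeightedLYM

variable {α : Type*} [DecidableEq α] [Fintype α]

section RowThreeSums
variable {𝒳 𝒵 : Finset (Finset α)}

/-- The C-set of the link at `d` seen from the doubled vertex `x`: `{y ∈ T : d+x+y ∈ 𝒳 ∩ 𝒵}`. [this work] -/
def csetL2 (𝒳 𝒵 : Finset (Finset α)) (m : α →₀ ℕ) (d x : α) : Finset α :=
  (lev m 1).filter fun y => insert d {x, y} ∈ 𝒳 ∧ insert d {x, y} ∈ 𝒵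

omit [Fintype α] in
/-- Membership in `csetL2`. [this work] -/
theorem mem_csetL2 {m : α →₀ ℕ} {d x y : α} :
    y ∈ csetL2 𝒳 𝒵 m d x ↔ y ∈ lev m 1 ∧ insert d {x, y} ∈ 𝒳 ∧ insert d {x, y} ∈ 𝒵 := by
  unfold csetL2; rw [mem_filter]

omit [Fintype α] in
/-- `Σ_{y₀ ∈ T} #(C∖y₀) = (τ − 1)·#C` for `C ⊆ T`. [folklore] -/
theorem sum_card_erase_eq {T C : Finset α} (hC : C ⊆ T) :
    ∑ y₀ ∈ T, (#(C.erase y₀) : ℤ) = ((#T : ℤ) - 1) * #C := by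
  have h : ∀ y₀ ∈ T, (#(C.erase y₀) : ℤ) = #C - if y₀ ∈ C then 1 else 0 := fun y₀ _ => by
    split_ifs with hy
    · rw [card_erase_of_mem hy]; have := card_pos.2 ⟨y₀, hy⟩; omega
    · rw [erase_eq_of_notMem hy]; ring
  rw [sum_congr rfl h, sum_sub_distrib, sum_const, nsmul_eq_mul, sum_boole]
  have : T.filter (fun y₀ => y₀ ∈ C) = C := by
    ext y; simp only [mem_filter, and_iff_right_iff_imp]; exact fun hy => hC hy
  rw [this]; ring

/-- **DEGREE sum with the α-edge**: if `D ∈ 𝒳 ∩ 𝒵` then for `d ∈ D`, `x ∈ D∖d` with C-set `C`,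
`Σ_{y₀ ∈ T} κ₂(d,y₀) ≥ 2τ + (τ−1)·#C` (`τ ≥ 2`). [this work] -/
theorem sum_kapL2_ge_deg_alpha (h𝒳 : IsUpperSet (𝒳 : Set (Finset α))) (h𝒵 : IsUpperSet (𝒵 : Set (Finset α)))
    (hX3 : ∀ S ∈ 𝒳, 3 ≤ #S) (hZ3 : ∀ S ∈ 𝒵, 3 ≤ #S) {m : α →₀ ℕ} (hD : #(dbl m) = 3) (hτ : 2 ≤ #(lev m 1)) {d : α} (hd : d ∈ dbl m)
    {x : α} (hx : x ∈ (dbl m).erase d) (hDX : dbl m ∈ 𝒳) (hDZ : dbl m ∈ 𝒵) :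
    2 * (#(lev m 1) : ℤ) + ((#(lev m 1) : ℤ) - 1) * #(csetL2 𝒳 𝒵 m d x) ≤ ∑ y₀ ∈ lev m 1, kapL2 𝒳 𝒵 m d y₀ := by
  -- the third doubled point
  have h2 : #((dbl m).erase d) = 2 := by rw [card_erase_of_mem hd, hD]
  obtain ⟨x', hx'⟩ : (((dbl m).erase d).erase x).Nonempty := card_pos.1 (by rw [card_erase_of_mem hx, h2]; norm_num)
  have hx'D : x' ∈ (dbl m).erase d := mem_of_mem_erase hx'
  have hxx' : x' ≠ x := ne_of_mem_erase hx'
  have hDeq : insert d {x, x'} = dbl m := by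
    apply eq_of_subset_of_card_le
    · exact insert_subset hd (insert_subset (mem_of_mem_erase hx) (singleton_subset_iff.2 (mem_of_mem_erase hx'D)))
    · rw [hD, card_insert_of_notMem, card_pair hxx'.symm]
      simp only [mem_insert, mem_singleton, not_or]
      exact ⟨(ne_of_mem_erase hx).symm, (ne_of_mem_erase hx'D).symm⟩
  have hCT : csetL2 𝒳 𝒵 m d x ⊆ lev m 1 := filter_subset _ _
  have hper : ∀ y₀ ∈ lev m 1, (2 : ℤ) + #((csetL2 𝒳 𝒵 m d x).erase y₀) ≤ kapL2 𝒳 𝒵 m d y₀ := fun y₀ hy₀ => by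
    set S := insert x' ((csetL2 𝒳 𝒵 m d x).erase y₀) with hS
    have hx'C : x' ∉ (csetL2 𝒳 𝒵 m d x).erase y₀ := fun h =>
      disjoint_left.1 (disjoint_dbl_lev_one m) (mem_of_mem_erase hx'D) (hCT (mem_of_mem_erase h))
    have hcardS : #S = #((csetL2 𝒳 𝒵 m d x).erase y₀) + 1 := card_insert_of_notMem hx'C
    have h := card_add_one_le_kapL2_of_nbrs h𝒳 h𝒵 hX3 hZ3 hD hd hy₀ hτ (v := x) (mem_union_left _ hx) (S := S)
      (fun u hu => by
        rcases mem_insert.1 hu with rfl | hu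
        · exact mem_erase.2 ⟨hxx', mem_union_left _ hx'D⟩
        · have huC := mem_of_mem_erase hu
          have huT : u ∈ lev m 1 := hCT huC
          refine mem_erase.2 ⟨fun h => disjoint_left.1 (disjoint_dbl_lev_one m) (mem_of_mem_erase hx) (h ▸ huT), ?_⟩
          exact mem_union_right _ (mem_erase.2 ⟨ne_of_mem_erase hu, huT⟩))
      (fun u hu => by
        rcases mem_insert.1 hu with rfl | hu
        · rw [hDeq]; exact ⟨hDX, hDZ⟩
        · exact (mem_csetL2.1 (mem_of_mem_erase hu)).2)
      ⟨x', mem_insert_self _ _⟩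
    rw [hcardS] at h; push_cast at h; linarith
  refine le_trans (le_of_eq ?_) (sum_le_sum hper)
  rw [sum_add_distrib, sum_const, nsmul_eq_mul, sum_card_erase_eq hCT]; ring

/-- **DEGREE sum without the α-edge**: for `d ∈ D`, `x ∈ D∖d` with C-set `C` of size `≥ 2`,
`Σ_{y₀ ∈ T} κ₂(d,y₀) ≥ τ + (τ−1)·#C` (`τ ≥ 2`). [this work] -/
theorem sum_kapL2_ge_deg (h𝒳 : IsUpperSet (𝒳 : Set (Finset α))) (h𝒵 : IsUpperSet (𝒵 : Set (Finset α)))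
    (hX3 : ∀ S ∈ 𝒳, 3 ≤ #S) (hZ3 : ∀ S ∈ 𝒵, 3 ≤ #S) {m : α →₀ ℕ} (hD : #(dbl m) = 3) (hτ : 2 ≤ #(lev m 1)) {d : α} (hd : d ∈ dbl m)
    {x : α} (hx : x ∈ (dbl m).erase d) (hC : 2 ≤ #(csetL2 𝒳 𝒵 m d x)) :
    (#(lev m 1) : ℤ) + ((#(lev m 1) : ℤ) - 1) * #(csetL2 𝒳 𝒵 m d x) ≤ ∑ y₀ ∈ lev m 1, kapL2 𝒳 𝒵 m d y₀ := by
  have hCT : csetL2 𝒳 𝒵 m d x ⊆ lev m 1 := filter_subset _ _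
  have hper : ∀ y₀ ∈ lev m 1, (1 : ℤ) + #((csetL2 𝒳 𝒵 m d x).erase y₀) ≤ kapL2 𝒳 𝒵 m d y₀ := fun y₀ hy₀ => by
    have hne : ((csetL2 𝒳 𝒵 m d x).erase y₀).Nonempty := card_pos.1 (by
      by_cases h : y₀ ∈ csetL2 𝒳 𝒵 m d x
      · rw [card_erase_of_mem h]; omega
      · rw [erase_eq_of_notMem h]; omega)
    have h := card_add_one_le_kapL2_of_nbrs h𝒳 h𝒵 hX3 hZ3 hD hd hy₀ hτ (v := x) (mem_union_left _ hx)
      (S := (csetL2 𝒳 𝒵 m d x).erase y₀)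
      (fun u hu => by
        have huC := mem_of_mem_erase hu
        have huT : u ∈ lev m 1 := hCT huC
        refine mem_erase.2 ⟨fun h => disjoint_left.1 (disjoint_dbl_lev_one m) (mem_of_mem_erase hx) (h ▸ huT), ?_⟩
        exact mem_union_right _ (mem_erase.2 ⟨ne_of_mem_erase hu, huT⟩))
      (fun u hu => (mem_csetL2.1 (mem_of_mem_erase hu)).2) hne
    linarith
  refine le_trans (le_of_eq ?_) (sum_le_sum hper)
  rw [sum_add_distrib, sum_const, nsmul_eq_mul, sum_card_erase_eq hCT]; ring

/-- **TRIANGLE sum**: if `D ∈ 𝒳 ∩ 𝒵` and the two C-sets at `d` (seen from `x` and from `x'`, the two points of `D∖d`) meet in at least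
two points, then every cube of the family has the α-triangle and `Σ_{y₀ ∈ T} κ₂(d,y₀) ≥ τ(τ+2)`. [this work] -/
theorem sum_kapL2_ge_tri (h𝒳 : IsUpperSet (𝒳 : Set (Finset α))) (h𝒵 : IsUpperSet (𝒵 : Set (Finset α)))
    (hX3 : ∀ S ∈ 𝒳, 3 ≤ #S) (hZ3 : ∀ S ∈ 𝒵, 3 ≤ #S) {m : α →₀ ℕ} (hD : #(dbl m) = 3) {d : α} (hd : d ∈ dbl m)
    {x x' : α} (hx : x ∈ (dbl m).erase d) (hx' : x' ∈ (dbl m).erase d) (hxx' : x ≠ x') (hDX : dbl m ∈ 𝒳) (hDZ : dbl m ∈ 𝒵)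
    (hI : 2 ≤ #(csetL2 𝒳 𝒵 m d x ∩ csetL2 𝒳 𝒵 m d x')) :
    (#(lev m 1) : ℤ) * (#(lev m 1) + 2) ≤ ∑ y₀ ∈ lev m 1, kapL2 𝒳 𝒵 m d y₀ := by
  have hper : ∀ y₀ ∈ lev m 1, (#(lev m 1) : ℤ) + 2 ≤ kapL2 𝒳 𝒵 m d y₀ := fun y₀ hy₀ => by
    obtain ⟨y, hy⟩ : ((csetL2 𝒳 𝒵 m d x ∩ csetL2 𝒳 𝒵 m d x').erase y₀).Nonempty := card_pos.1 (by
      by_cases h : y₀ ∈ csetL2 𝒳 𝒵 m d x ∩ csetL2 𝒳 𝒵 m d x'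
      · rw [card_erase_of_mem h]; omega
      · rw [erase_eq_of_notMem h]; omega)
    obtain ⟨hyy₀, hyI⟩ := mem_erase.1 hy
    obtain ⟨hyC, hyC'⟩ := mem_inter.1 hyI
    exact tau_add_two_le_kapL2_of_triangle h𝒳 h𝒵 hX3 hZ3 hD hd hy₀ hx hx' hxx' (mem_erase.2 ⟨hyy₀, (mem_csetL2.1 hyC).1⟩) hDX hDZ
      (mem_csetL2.1 hyC).2 (mem_csetL2.1 hyC').2
  have := sum_le_sum hper
  rw [sum_const, nsmul_eq_mul] at this
  linarith

/-! #### The 1-live cubes -/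

omit [Fintype α] in
/-- With the α-loop every 1-live cube counts: `Σ_{Q} κ₁(d,Q) ≥ C(τ,2)`. [this work] -/
theorem sum_kapL1_ge_alpha (h𝒳 : IsUpperSet (𝒳 : Set (Finset α))) (h𝒵 : IsUpperSet (𝒵 : Set (Finset α)))
    (hX3 : ∀ S ∈ 𝒳, 3 ≤ #S) (hZ3 : ∀ S ∈ 𝒵, 3 ≤ #S) {m : α →₀ ℕ} (hD : #(dbl m) = 3) {d : α} (hd : d ∈ dbl m)
    (hDX : dbl m ∈ 𝒳) (hDZ : dbl m ∈ 𝒵) :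
    ((#(lev m 1)).choose 2 : ℤ) ≤ ∑ Q ∈ (lev m 1).powersetCard 2, kapL1 𝒳 𝒵 m d Q := by
  have := sum_le_sum fun Q (_ : Q ∈ (lev m 1).powersetCard 2) => one_le_kapL1_of_dbl_mem h𝒳 h𝒵 hX3 hZ3 hD hd Q hDX hDZ
  rw [sum_const, card_powersetCard, nsmul_eq_mul, mul_one] at this
  exact_mod_cast this

omit [Fintype α] in
/-- If the C-set `{y ∈ T : (D∖d)+y ∈ 𝒳 ∩ 𝒵}` of the pair `D∖d` has at least three points then every 1-live cube `(d,Q)` has a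
C-loop: `Σ_{Q} κ₁(d,Q) ≥ C(τ,2)`. [this work] -/
theorem sum_kapL1_ge_of_three_le (h𝒳 : IsUpperSet (𝒳 : Set (Finset α))) (h𝒵 : IsUpperSet (𝒵 : Set (Finset α)))
    (hX3 : ∀ S ∈ 𝒳, 3 ≤ #S) (hZ3 : ∀ S ∈ 𝒵, 3 ≤ #S) {m : α →₀ ℕ} (hD : #(dbl m) = 3) {d : α} (hd : d ∈ dbl m)
    (hC : 3 ≤ #((lev m 1).filter fun y => insert y ((dbl m).erase d) ∈ 𝒳 ∧ insert y ((dbl m).erase d) ∈ 𝒵)) :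
    ((#(lev m 1)).choose 2 : ℤ) ≤ ∑ Q ∈ (lev m 1).powersetCard 2, kapL1 𝒳 𝒵 m d Q := by
  set C := (lev m 1).filter fun y => insert y ((dbl m).erase d) ∈ 𝒳 ∧ insert y ((dbl m).erase d) ∈ 𝒵
  have hper : ∀ Q ∈ (lev m 1).powersetCard 2, (1 : ℤ) ≤ kapL1 𝒳 𝒵 m d Q := fun Q hQ => by
    obtain ⟨y, hy⟩ : (C \ Q).Nonempty := by
      rw [← card_pos]
      have h1 : #(C \ Q) + #(C ∩ Q) = #C := card_sdiff_add_card_inter C Q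
      have h2 : #(C ∩ Q) ≤ 2 := (card_le_card inter_subset_right).trans (mem_powersetCard.1 hQ).2.le
      omega
    obtain ⟨hyC, hyQ⟩ := mem_sdiff.1 hy
    obtain ⟨hyT, hyX, hyZ⟩ := mem_filter.1 hyC
    exact one_le_kapL1_of_C h𝒳 h𝒵 hX3 hZ3 hD hd (mem_sdiff.2 ⟨hyT, hyQ⟩) hyX hyZ
  have := sum_le_sum hper
  rw [sum_const, card_powersetCard, nsmul_eq_mul, mul_one] at this
  exact_mod_cast this

/-! #### Counting the C₁-type charged sets -/

omit [Fintype α] in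
/-- The charged sets meeting `D` in one point are covered by the pairs `(d, Q)`, `d ∈ D`, `Q ⊆ T` a pair, with `d + Q ∈ W`; hence
`#{w ∈ W : 1_w ≤ m, #(D∩w) = 1} ≤ Σ_d #{Q : d + Q ∈ W} ≤ 3·C(τ,2)`. [this work] -/
theorem card_WC1_le_sum {m : α →₀ ℕ} (hm : ∀ i, m i ≤ 2) (W : Finset (Finset α)) (hW : ∀ w ∈ W, #w = 3) :
    #((W.filter fun w => ind w ≤ m).filter fun w => #(dbl m ∩ w) = 1) ≤
      ∑ d ∈ dbl m, #(((lev m 1).powersetCard 2).filter fun Q => insert d Q ∈ W) := by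
  set WC := (W.filter fun w => ind w ≤ m).filter fun w => #(dbl m ∩ w) = 1
  set Dom := (dbl m ×ˢ (lev m 1).powersetCard 2).filter fun q => insert q.1 q.2 ∈ W
  have h1 : #WC ≤ #Dom := by
    refine card_le_card_of_surjOn (fun q => insert q.1 q.2) fun w hw => ?_
    obtain ⟨hw', hDw⟩ := mem_filter.1 (Finset.mem_coe.1 hw)
    obtain ⟨hwW, hwm⟩ := mem_filter.1 hw'
    have hwsupp : w ⊆ dbl m ∪ lev m 1 := support_eq_dbl_union_lev hm ▸ (SahiAllButC.ind_le_iff_subset_support _ _).1 hwm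
    obtain ⟨d, hd⟩ := card_eq_one.1 hDw
    have hdw : d ∈ dbl m ∩ w := by rw [hd]; exact mem_singleton_self d
    have hQ : w \ dbl m ⊆ lev m 1 := fun y hy => (mem_union.1 (hwsupp (mem_sdiff.1 hy).1)).resolve_left (mem_sdiff.1 hy).2
    have hQ2 : #(w \ dbl m) = 2 := by
      have := card_sdiff_add_card_inter w (dbl m); rw [inter_comm, hDw, hW w hwW] at this; omega
    have heq : insert d (w \ dbl m) = w := by
      ext i; simp only [mem_insert, mem_sdiff]
      constructor
      · rintro (rfl | ⟨hi, _⟩)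
        · exact (mem_inter.1 hdw).2
        · exact hi
      · intro hi
        by_cases hiD : i ∈ dbl m
        · have : i ∈ dbl m ∩ w := mem_inter.2 ⟨hiD, hi⟩
          rw [hd, mem_singleton] at this; exact Or.inl this
        · exact Or.inr ⟨hi, hiD⟩
    refine ⟨(d, w \ dbl m), Finset.mem_coe.2 (mem_filter.2 ⟨mem_product.2 ⟨(mem_inter.1 hdw).1, mem_powersetCard.2 ⟨hQ, hQ2⟩⟩, ?_⟩), heq⟩
    show insert d (w \ dbl m) ∈ W
    rw [heq]; exact hwW
  refine h1.trans (le_of_eq ?_)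
  rw [card_filter, sum_product]
  refine sum_congr rfl fun d _ => ?_
  rw [card_filter]

omit [Fintype α] in
/-- Consequently `#{w ∈ W : 1_w ≤ m, #(D∩w) = 1} ≤ #D · C(τ,2)`. [this work] -/
theorem card_WC1_le {m : α →₀ ℕ} (hm : ∀ i, m i ≤ 2) (W : Finset (Finset α)) (hW : ∀ w ∈ W, #w = 3) :
    #((W.filter fun w => ind w ≤ m).filter fun w => #(dbl m ∩ w) = 1) ≤ #(dbl m) * (#(lev m 1)).choose 2 := by
  refine (card_WC1_le_sum hm W hW).trans ?_
  have : ∀ d ∈ dbl m, #(((lev m 1).powersetCard 2).filter fun Q => insert d Q ∈ W) ≤ (#(lev m 1)).choose 2 := fun d _ =>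
    (card_filter_le _ _).trans (card_powersetCard _ _).le
  refine (sum_le_sum this).trans ?_
  rw [sum_const, smul_eq_mul]

end RowThreeSums

end Summit.CriticalPhenomena.PercolationContinuityZ3.Theorems.SahiCTCForms
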